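/-
Copyright: the b2b-balaban T⁴-continuum CRUX team, row NE7b OWNER lineage `t4-ne7b-p1` (gen 142). Project licence.
-/
import Summits.QuantumFields.BalabanUV.T4Continuum.Spine.NE7b.SupBlockFourthKernelAverage
import Summits.QuantumFields.BalabanUV.T4Continuum.Spine.NE7b.SupWhitenedFourthCumulantTree
import Summits.QuantumFields.BalabanUV.T4Continuum.Spine.NE7b.SupWhitenedFourthKernelPieces

/-!
# TWO ENTRY PIECES FOR THE ORDER-FOUR CLASS MAP: THE TILTED AVERAGE OF A `U⁗`-ENTRY AND THE FOURTH CUMULANT'S ENTRY IN THE TILTED FORMAT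
# (SCOPING (d13)(2) → the order-4 block of the kernel-letter CLASS MAP, first file).  The entrywise majorant of `∂⁴W` (next file) needs, besides
# the two-point ((501)∕(502)) and three-point ((508)∕(509)) ENTRY bounds already in the tree, (§1) the average entry
# `|Z⁻¹∫e^{−U(ω+ψ)}U⁗(ω+ψ)[e_x,e_y,e_z,e_t]dN(0,Γ)| ≤ K4_{yztx}` for an entrywise majorant `|U⁗(φ)[e_u,e_x,e_y,e_z]| ≤ K4_{xyzu}` (a weighted
# average is at most the sup; (437) on the one-point index; general `Γ ⪰ 0`), and (§2) (497)'s sixteen-tree decay of the fourth cumulant's ENTRY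
# restated in the tilted `N(0,AAᵀ)` format of (521)'s display by (522)'s bridges, with the sixth-moment letter DISCHARGED by (505)
# (`M₆ = 50κ₂⁶γ_op³∕(1−λγ_op)³`) (row NE7b, node U5c; (500), (437), (497), (505), (522) BY NAME; [folklore])

Cell `pub-balaban`, sub-cell `t4`, spine estimate NE7b (`T4WeightBudget.RelWeightBound`; the cell's OWN estimate — NOT PRINTED in
[Bałaban 1983–89], NOT PROVED).  Crux-route work under `Spine/NE7b/` by the row OWNER (`t4-ne7b-p1` gen 142, file (525)) under FREEZE
(0)'s crux-prover clause; NOTHING of Bałaban's is named as a Lean object, valued or asserted; no `T4Continuum/Support` leaf typed; no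
`def`, no notation; zero `sorry`.  Imports (BY NAME): the OWNER's (500) `…SupBlockFourthKernelAverage` (`integrable_weighted_fourth_entry`; (437)
`rowsum_of_weighted_average`, (410) `block_Z_pos`, (401) `integrable_exp_neg_block`), (497) `…SupWhitenedFourthCumulantTree`
(`whitened_fourth_cumulant_tree`), (522) `…SupWhitenedFourthKernelPieces` (bridges; (505) `whitened_sixth_power_integrable`,
`whitened_sixth_moment_gibbs` and (475) `whitened_mean_bridge` through it).

WHAT IS PROVED ([folklore]): §1 `tilted_fourth_average_entry` (general `Γ ⪰ 0`); §2 `fourth_cumulant_entry_tilted`; §3 toy.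

HONEST (what this is NOT).  Two entry bounds; the entrywise majorant, its fixed-slot letters and the class map are the next files.  Scalar
skeleton ((A3), NC-NE7b-α UNRULED); nothing of Bałaban's asserted.  BY-NAME EFFECT ON THE WALL: NONE.  NE7b NOT PRINTED ∕ NOT PROVED; spine PROVED
0∕9; rung (B)+1 — the programme's measures remain FINITE-torus statements; NOT the mass gap, NOT Clay.  HONEST DEPENDENCY: continuum YM on T⁴ ⇐
BetaPertH ∧ nine spine estimates (0∕9 proved); BetaPertH ⇐ (D1) ∧ (D4) ∧ CAP+tail; G-an2-4 gates asym, D1 and NE2∕3∕4.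
-/

set_option autoImplicit false
set_option maxSynthPendingDepth 3

noncomputable section

namespace Summit.QuantumFields.BalabanUV.T4Continuum.NE7b.SupFourthKernelEntryPieces

open MeasureTheory ProbabilityTheory Finset Real Matrix
open scoped BigOperators Matrix
open Literature.Probability.Distributions (matrixCLM)
open SupEffectiveActionDerivative (mul_opBound_le_of_le)
open SupBlockEffectiveActionDerivative (integrable_exp_neg_block)
open SupBlockDressedStep (block_Z_pos)
open SupBlockHessianKernelAverage (rowsum_of_weighted_average)
open SupBlockFourthKernelAverage (integrable_weighted_fourth_entry)
open SupWhitenedFourthCumulantTree (whitened_fourth_cumulant_tree)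
open SupWhitenedSixthMoment (whitened_sixth_power_integrable whitened_sixth_moment_gibbs)
open SupWhitenedThirdKernelLetter (whitened_mean_bridge)
open SupWhitenedFourthKernelPieces (whitened_pair_bridge whitened_quad_bridge)

variable {ι κ : Type} [Fintype ι] [DecidableEq ι] [Fintype κ] [DecidableEq κ]

/-! ## §1. The average entry (general `Γ ⪰ 0`) -/

section Average

variable {Γ : Matrix ι ι ℝ} {γop : ℝ} {U : EuclideanSpace ℝ ι → ℝ} {U' : EuclideanSpace ℝ ι → EuclideanSpace ℝ ι →L[ℝ] ℝ}
  {U₄ : EuclideanSpace ℝ ι → EuclideanSpace ℝ ι →L[ℝ] EuclideanSpace ℝ ι →L[ℝ] EuclideanSpace ℝ ι →L[ℝ] EuclideanSpace ℝ ι →L[ℝ] ℝ} {K4 : ι → ι → ι →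
      ι → ℝ}
  {κ₀ κ₄ τ δ θp : ℝ}

omit [Fintype κ] [DecidableEq κ] in
/-- **THE AVERAGE ENTRY**: `|Z⁻¹∫e^{−U(ω+ψ)}U⁗(ω+ψ)[e_x,e_y,e_z,e_t]dN(0,Γ)| ≤ K4_{yztx}` for an entrywise majorant `|U⁗(φ)[e_u,e_x,e_y,e_z]| ≤ K4_{xyzu}`
((437) on the one-point index). [folklore] -/
theorem tilted_fourth_average_entry (hΓ : Γ.PosSemidef) (hΓop : (γop • (1 : Matrix ι ι ℝ) - Γ).PosSemidef) (Y : Finset ι)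
    (hUd : ∀ φ : EuclideanSpace ℝ ι, HasFDerivAt U (U' φ) φ) (hU₄c : Continuous U₄) (hκ₀ : 0 ≤ κ₀) (hτ : 0 < τ) (hδ : 0 < δ) (hθ0 : 0 < θp)
    (hθ1 : θp < 1) (hκθ : (2 * κ₀ * (1 + τ) + 4 * δ) * γop ≤ θp) (hstab : ∀ φ : EuclideanSpace ℝ ι, -(κ₀ * ∑ x ∈ Y, φ x ^ 2) ≤ U φ)
    (hU₄b : ∀ φ : EuclideanSpace ℝ ι, ‖U₄ φ‖ ≤ κ₄)
    (hK4 : ∀ (φ : EuclideanSpace ℝ ι) (u x y z : ι), |U₄ φ (EuclideanSpace.single u (1 : ℝ)) (EuclideanSpace.single x (1 : ℝ))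
      (EuclideanSpace.single y (1 : ℝ)) (EuclideanSpace.single z (1 : ℝ))| ≤ K4 x y z u)
    (ψ : EuclideanSpace ℝ ι) (x y z t : ι) :
    |(∫ ω : EuclideanSpace ℝ ι, exp (-U (ω + ψ)) ∂(multivariateGaussian 0 Γ))⁻¹ * (∫ ω : EuclideanSpace ℝ ι, exp (-U (ω + ψ)) * U₄ (ω + ψ)
        (EuclideanSpace.single x (1 : ℝ)) (EuclideanSpace.single y (1 : ℝ)) (EuclideanSpace.single z (1 : ℝ)) (EuclideanSpace.single t (1 : ℝ))
        ∂(multivariateGaussian 0 Γ))| ≤ K4 y z t x := by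
  have hUc : Continuous U := continuous_iff_continuousAt.2 fun φ => (hUd φ).continuousAt
  have hκθ₀ : 2 * κ₀ * (1 + τ) * γop ≤ θp := mul_opBound_le_of_le (by positivity) (by linarith) hθ0.le hκθ
  have hI := integrable_exp_neg_block hΓ hΓop Y hUc.measurable hκ₀ hτ hθ1 hκθ₀ hstab ψ
  have hZ := block_Z_pos hΓ hΓop Y hUd hκ₀ hτ hδ hθ0 hθ1 hκθ hstab ψ
  have hint := integrable_weighted_fourth_entry hΓ hΓop Y hUd hU₄c hκ₀ hτ hδ hθ0 hθ1 hκθ hstab hU₄b ψ x y z t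
  have h := rowsum_of_weighted_average (multivariateGaussian 0 Γ) (fun ω : EuclideanSpace ℝ ι => exp (-U (ω + ψ)))
    (fun (ω : EuclideanSpace ℝ ι) (_ : Unit) (_ : Unit) => U₄ (ω + ψ) (EuclideanSpace.single x (1 : ℝ)) (EuclideanSpace.single y (1 : ℝ))
        (EuclideanSpace.single z (1 : ℝ)) (EuclideanSpace.single t (1 : ℝ)))
    (fun ω => (exp_pos _).le) hI hZ (fun _ _ => hint) (fun ω _ => by simpa using hK4 (ω + ψ) x y z t) ()
  simpa using h

end Average

/-! ## §2. The fourth cumulant's entry in the tilted format, sixth moment discharged -/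

section Kappa4

variable {U : EuclideanSpace ℝ ι → ℝ} {U' : EuclideanSpace ℝ ι → EuclideanSpace ℝ ι →L[ℝ] ℝ}
  {U'' : EuclideanSpace ℝ ι → EuclideanSpace ℝ ι →L[ℝ] EuclideanSpace ℝ ι →L[ℝ] ℝ} {Hk : ι → ι → ℝ} {A : Matrix ι κ ℝ} {D : κ → κ → ℝ}
  {γop κ₀ κ₁ κ₂ a τ δ θp lam lamA αr αc hr γ dθ dθ' αθ βθ : ℝ} {θ : κ → κ → ℝ} {σ : ι → κ → ℝ} {r : ι → ι → ℝ}

/-- **THE FOURTH CUMULANT'S ENTRY, TILTED FORMAT** ((497) with `M₆ = 50κ₂⁶γ_op³∕(1−λγ_op)³` from (505), bridged by (522)): tree decay over the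
sixteen labelled spanning trees of `{x,y,z,t}`. [folklore] -/
theorem fourth_cumulant_entry_tilted [Nonempty κ] (hΓop : (γop • (1 : Matrix ι ι ℝ) - A * Aᵀ).PosSemidef) (Y : Finset ι)
    (hUd : ∀ φ : EuclideanSpace ℝ ι, HasFDerivAt U (U' φ) φ) (hU'd : ∀ φ : EuclideanSpace ℝ ι, HasFDerivAt U' (U'' φ) φ)
    (hU''c : Continuous U'') (hκ₀ : 0 ≤ κ₀) (hκ₁ : 0 ≤ κ₁) (ha : 0 ≤ a) (hτ : 0 < τ) (hδ : 0 < δ) (hθ0 : 0 < θp) (hθ1 : θp < 1)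
    (hκθ : (2 * κ₀ * (1 + τ) + 4 * δ) * γop ≤ θp) (hκθw : 2 * κ₀ * (1 + τ) * γop + 4 * δ ≤ θp)
    (hstab : ∀ φ : EuclideanSpace ℝ ι, -(κ₀ * ∑ x ∈ Y, φ x ^ 2) ≤ U φ)
    (hU'b : ∀ φ : EuclideanSpace ℝ ι, ‖U' φ‖ ≤ κ₁ * (a + ∑ x ∈ Y, φ x ^ 2)) (hU''b : ∀ φ : EuclideanSpace ℝ ι, ‖U'' φ‖ ≤ κ₂) (hlam : 0 ≤ lam)
    (hUsec : ∀ s : ℝ, 0 ≤ s → s ≤ 1 → ∀ a b : EuclideanSpace ℝ ι,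
      U ((1 - s) • a + s • b) - lam / 2 * (s * (1 - s)) * ∑ i, (a i - b i) ^ 2 ≤ (1 - s) * U a + s * U b)
    (hρg : lam * γop < 1)
    (hHk : ∀ (φ : EuclideanSpace ℝ ι) (x z : ι), |U'' φ (EuclideanSpace.single z (1 : ℝ)) (EuclideanSpace.single x (1 : ℝ))| ≤ Hk x z)
    (hHk0 : ∀ v u, 0 ≤ Hk v u) (ψ : EuclideanSpace ℝ ι)
    (hαr : ∀ u, ∑ w, |A u w| ≤ αr) (hαc : ∀ w, ∑ u, |A u w| ≤ αc) (hhr : ∀ v, ∑ u, Hk v u ≤ hr)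
    (hlamA : ∀ x : κ, ∑ u, ∑ v, |A u x| * |A v x| * Hk v u ≤ lamA) (hlamA1 : lamA < 1) (hγ : αc * hr * αr / (1 - lamA) ≤ γ) (hγ1 : γ < 1)
    (hD : ∀ x y, 0 ≤ D x y)
    (hDC : ∀ x y, (if x = y then (1 : ℝ) else 0) + ∑ z, D x z * ((if y = z then 0 else ∑ u, ∑ v, |A u y| * |A v z| * Hk v u) / (1 - lamA)) ≤ D x y)
    (hθnn : ∀ z w, 0 ≤ θ z w) (hDθr : ∀ z, ∑ w, D z w * θ z w ≤ dθ) (hdθ : 0 ≤ dθ) (hDθc : ∀ w, ∑ z, D z w * θ z w ≤ dθ') (hdθ' : 0 ≤ dθ')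
    (hσ0 : ∀ x w, 0 ≤ σ x w) (hσθ : ∀ x z w, σ x w ≤ σ x z * θ z w) (hr1 : ∀ x y, 1 ≤ r x y) (hrσ : ∀ x y w, r x y ^ 24 ≤ σ x w * σ y w)
    (haσ : ∀ v : ι, ∑ w, (∑ u, |A u w| * Hk v u) * σ v w ≤ αθ) (hβ : 0 ≤ βθ) (haσ' : ∀ (v : ι) (w : κ), (∑ u, |A u w| * Hk v u) * σ v w ≤ βθ)
    (x y z t : ι) :
    |(∫ ω : EuclideanSpace ℝ ι, exp (-U (ω + ψ)) ∂(multivariateGaussian 0 (A * Aᵀ)))⁻¹ * (∫ ω : EuclideanSpace ℝ ι, exp (-U (ω + ψ)) * ((U' (ω + ψ)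
        (EuclideanSpace.single x (1 : ℝ)) - ((∫ ω : EuclideanSpace ℝ ι, exp (-U (ω + ψ)) ∂(multivariateGaussian 0 (A * Aᵀ)))⁻¹ * (∫ ω :
        EuclideanSpace ℝ ι, exp (-U (ω + ψ)) * U' (ω + ψ) (EuclideanSpace.single x (1 : ℝ)) ∂(multivariateGaussian 0 (A * Aᵀ))))) * (U' (ω + ψ)
        (EuclideanSpace.single y (1 : ℝ)) - ((∫ ω : EuclideanSpace ℝ ι, exp (-U (ω + ψ)) ∂(multivariateGaussian 0 (A * Aᵀ)))⁻¹ * (∫ ω :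
        EuclideanSpace ℝ ι, exp (-U (ω + ψ)) * U' (ω + ψ) (EuclideanSpace.single y (1 : ℝ)) ∂(multivariateGaussian 0 (A * Aᵀ))))) * (U' (ω + ψ)
        (EuclideanSpace.single z (1 : ℝ)) - ((∫ ω : EuclideanSpace ℝ ι, exp (-U (ω + ψ)) ∂(multivariateGaussian 0 (A * Aᵀ)))⁻¹ * (∫ ω :
        EuclideanSpace ℝ ι, exp (-U (ω + ψ)) * U' (ω + ψ) (EuclideanSpace.single z (1 : ℝ)) ∂(multivariateGaussian 0 (A * Aᵀ))))) * (U' (ω + ψ)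
        (EuclideanSpace.single t (1 : ℝ)) - ((∫ ω : EuclideanSpace ℝ ι, exp (-U (ω + ψ)) ∂(multivariateGaussian 0 (A * Aᵀ)))⁻¹ * (∫ ω :
        EuclideanSpace ℝ ι, exp (-U (ω + ψ)) * U' (ω + ψ) (EuclideanSpace.single t (1 : ℝ)) ∂(multivariateGaussian 0 (A * Aᵀ))))))
        ∂(multivariateGaussian 0 (A * Aᵀ))) - ((∫ ω : EuclideanSpace ℝ ι, exp (-U (ω + ψ)) ∂(multivariateGaussian 0 (A * Aᵀ)))⁻¹ * (∫ ω :
        EuclideanSpace ℝ ι, exp (-U (ω + ψ)) * ((U' (ω + ψ) (EuclideanSpace.single x (1 : ℝ)) - ((∫ ω : EuclideanSpace ℝ ι, exp (-U (ω + ψ))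
        ∂(multivariateGaussian 0 (A * Aᵀ)))⁻¹ * (∫ ω : EuclideanSpace ℝ ι, exp (-U (ω + ψ)) * U' (ω + ψ) (EuclideanSpace.single x (1 : ℝ))
        ∂(multivariateGaussian 0 (A * Aᵀ))))) * (U' (ω + ψ) (EuclideanSpace.single y (1 : ℝ)) - ((∫ ω : EuclideanSpace ℝ ι, exp (-U (ω + ψ))
        ∂(multivariateGaussian 0 (A * Aᵀ)))⁻¹ * (∫ ω : EuclideanSpace ℝ ι, exp (-U (ω + ψ)) * U' (ω + ψ) (EuclideanSpace.single y (1 : ℝ))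
        ∂(multivariateGaussian 0 (A * Aᵀ)))))) ∂(multivariateGaussian 0 (A * Aᵀ)))) * ((∫ ω : EuclideanSpace ℝ ι, exp (-U (ω + ψ))
        ∂(multivariateGaussian 0 (A * Aᵀ)))⁻¹ * (∫ ω : EuclideanSpace ℝ ι, exp (-U (ω + ψ)) * ((U' (ω + ψ) (EuclideanSpace.single z (1 : ℝ)) - ((∫ ω
        : EuclideanSpace ℝ ι, exp (-U (ω + ψ)) ∂(multivariateGaussian 0 (A * Aᵀ)))⁻¹ * (∫ ω : EuclideanSpace ℝ ι, exp (-U (ω + ψ)) * U' (ω + ψ)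
        (EuclideanSpace.single z (1 : ℝ)) ∂(multivariateGaussian 0 (A * Aᵀ))))) * (U' (ω + ψ) (EuclideanSpace.single t (1 : ℝ)) - ((∫ ω :
        EuclideanSpace ℝ ι, exp (-U (ω + ψ)) ∂(multivariateGaussian 0 (A * Aᵀ)))⁻¹ * (∫ ω : EuclideanSpace ℝ ι, exp (-U (ω + ψ)) * U' (ω + ψ)
        (EuclideanSpace.single t (1 : ℝ)) ∂(multivariateGaussian 0 (A * Aᵀ)))))) ∂(multivariateGaussian 0 (A * Aᵀ)))) - ((∫ ω : EuclideanSpace ℝ ι,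
        exp (-U (ω + ψ)) ∂(multivariateGaussian 0 (A * Aᵀ)))⁻¹ * (∫ ω : EuclideanSpace ℝ ι, exp (-U (ω + ψ)) * ((U' (ω + ψ) (EuclideanSpace.single x
        (1 : ℝ)) - ((∫ ω : EuclideanSpace ℝ ι, exp (-U (ω + ψ)) ∂(multivariateGaussian 0 (A * Aᵀ)))⁻¹ * (∫ ω : EuclideanSpace ℝ ι, exp (-U (ω + ψ)) *
        U' (ω + ψ) (EuclideanSpace.single x (1 : ℝ)) ∂(multivariateGaussian 0 (A * Aᵀ))))) * (U' (ω + ψ) (EuclideanSpace.single z (1 : ℝ)) - ((∫ ω :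
        EuclideanSpace ℝ ι, exp (-U (ω + ψ)) ∂(multivariateGaussian 0 (A * Aᵀ)))⁻¹ * (∫ ω : EuclideanSpace ℝ ι, exp (-U (ω + ψ)) * U' (ω + ψ)
        (EuclideanSpace.single z (1 : ℝ)) ∂(multivariateGaussian 0 (A * Aᵀ)))))) ∂(multivariateGaussian 0 (A * Aᵀ)))) * ((∫ ω : EuclideanSpace ℝ ι,
        exp (-U (ω + ψ)) ∂(multivariateGaussian 0 (A * Aᵀ)))⁻¹ * (∫ ω : EuclideanSpace ℝ ι, exp (-U (ω + ψ)) * ((U' (ω + ψ) (EuclideanSpace.single y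
        (1 : ℝ)) - ((∫ ω : EuclideanSpace ℝ ι, exp (-U (ω + ψ)) ∂(multivariateGaussian 0 (A * Aᵀ)))⁻¹ * (∫ ω : EuclideanSpace ℝ ι, exp (-U (ω + ψ)) *
        U' (ω + ψ) (EuclideanSpace.single y (1 : ℝ)) ∂(multivariateGaussian 0 (A * Aᵀ))))) * (U' (ω + ψ) (EuclideanSpace.single t (1 : ℝ)) - ((∫ ω :
        EuclideanSpace ℝ ι, exp (-U (ω + ψ)) ∂(multivariateGaussian 0 (A * Aᵀ)))⁻¹ * (∫ ω : EuclideanSpace ℝ ι, exp (-U (ω + ψ)) * U' (ω + ψ)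
        (EuclideanSpace.single t (1 : ℝ)) ∂(multivariateGaussian 0 (A * Aᵀ)))))) ∂(multivariateGaussian 0 (A * Aᵀ)))) - ((∫ ω : EuclideanSpace ℝ ι,
        exp (-U (ω + ψ)) ∂(multivariateGaussian 0 (A * Aᵀ)))⁻¹ * (∫ ω : EuclideanSpace ℝ ι, exp (-U (ω + ψ)) * ((U' (ω + ψ) (EuclideanSpace.single x
        (1 : ℝ)) - ((∫ ω : EuclideanSpace ℝ ι, exp (-U (ω + ψ)) ∂(multivariateGaussian 0 (A * Aᵀ)))⁻¹ * (∫ ω : EuclideanSpace ℝ ι, exp (-U (ω + ψ)) *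
        U' (ω + ψ) (EuclideanSpace.single x (1 : ℝ)) ∂(multivariateGaussian 0 (A * Aᵀ))))) * (U' (ω + ψ) (EuclideanSpace.single t (1 : ℝ)) - ((∫ ω :
        EuclideanSpace ℝ ι, exp (-U (ω + ψ)) ∂(multivariateGaussian 0 (A * Aᵀ)))⁻¹ * (∫ ω : EuclideanSpace ℝ ι, exp (-U (ω + ψ)) * U' (ω + ψ)
        (EuclideanSpace.single t (1 : ℝ)) ∂(multivariateGaussian 0 (A * Aᵀ)))))) ∂(multivariateGaussian 0 (A * Aᵀ)))) * ((∫ ω : EuclideanSpace ℝ ι,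
        exp (-U (ω + ψ)) ∂(multivariateGaussian 0 (A * Aᵀ)))⁻¹ * (∫ ω : EuclideanSpace ℝ ι, exp (-U (ω + ψ)) * ((U' (ω + ψ) (EuclideanSpace.single y
        (1 : ℝ)) - ((∫ ω : EuclideanSpace ℝ ι, exp (-U (ω + ψ)) ∂(multivariateGaussian 0 (A * Aᵀ)))⁻¹ * (∫ ω : EuclideanSpace ℝ ι, exp (-U (ω + ψ)) *
        U' (ω + ψ) (EuclideanSpace.single y (1 : ℝ)) ∂(multivariateGaussian 0 (A * Aᵀ))))) * (U' (ω + ψ) (EuclideanSpace.single z (1 : ℝ)) - ((∫ ω :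
        EuclideanSpace ℝ ι, exp (-U (ω + ψ)) ∂(multivariateGaussian 0 (A * Aᵀ)))⁻¹ * (∫ ω : EuclideanSpace ℝ ι, exp (-U (ω + ψ)) * U' (ω + ψ)
        (EuclideanSpace.single z (1 : ℝ)) ∂(multivariateGaussian 0 (A * Aᵀ)))))) ∂(multivariateGaussian 0 (A * Aᵀ))))| ≤
      (4 * (αθ * dθ * (βθ * dθ') / (1 - lamA)) + 3 * (αθ * dθ * (βθ * dθ') / (1 - lamA)) ^ 2 + 4 * (5 * (κ₂ ^ 4 * γop ^ 2) / (1 - lam * γop) ^ 2) + 4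
          * (50 * (κ₂ ^ 6 * γop ^ 3) / (1 - lam * γop) ^ 3) + 2 * (((5 * (κ₂ ^ 4 * γop ^ 2) / (1 - lam * γop) ^ 2) + 1) / 2) * ((((5 * (κ₂ ^ 4 * γop
              ^ 2) / (1 - lam * γop) ^ 2) + 1) / 2) + (5 *
          (κ₂ ^ 4 * γop ^ 2) / (1 - lam * γop) ^ 2))) *
        ((r x y ^ 2)⁻¹ * (r x z ^ 2)⁻¹ * (r x t ^ 2)⁻¹ + (r x y ^ 2)⁻¹ * (r y z ^ 2)⁻¹ * (r y t ^ 2)⁻¹ + (r x z ^ 2)⁻¹ * (r y z ^ 2)⁻¹ * (r z t ^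
            2)⁻¹ + (r x t ^ 2)⁻¹ * (r y t ^ 2)⁻¹ * (r z t ^ 2)⁻¹ + (r x y ^ 2)⁻¹ * (r y z ^ 2)⁻¹ * (r z t ^ 2)⁻¹ + (r x y ^ 2)⁻¹ * (r y t ^ 2)⁻¹ * (r
            z t ^ 2)⁻¹ + (r x z ^ 2)⁻¹ * (r y z ^ 2)⁻¹ * (r y t ^ 2)⁻¹ + (r x z ^ 2)⁻¹ * (r y t ^ 2)⁻¹ * (r z t ^ 2)⁻¹ + (r x t ^ 2)⁻¹ * (r y z ^
            2)⁻¹ * (r y t ^ 2)⁻¹ + (r x t ^ 2)⁻¹ * (r y z ^ 2)⁻¹ * (r z t ^ 2)⁻¹ + (r x y ^ 2)⁻¹ * (r x z ^ 2)⁻¹ * (r z t ^ 2)⁻¹ + (r x y ^ 2)⁻¹ * (r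
            x t ^ 2)⁻¹ * (r z t ^ 2)⁻¹ + (r x y ^ 2)⁻¹ * (r x z ^ 2)⁻¹ * (r y t ^ 2)⁻¹ + (r x z ^ 2)⁻¹ * (r x t ^ 2)⁻¹ * (r y t ^ 2)⁻¹ + (r x y ^
            2)⁻¹ * (r x t ^ 2)⁻¹ * (r y z ^ 2)⁻¹ + (r x z ^ 2)⁻¹ * (r x t ^ 2)⁻¹ * (r y z ^ 2)⁻¹) := by
  haveI : Nonempty ι := ⟨x⟩
  have hUc : Continuous U := continuous_iff_continuousAt.2 fun φ => (hUd φ).continuousAt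
  have hU'c : Continuous U' := continuous_iff_continuousAt.2 fun φ => (hU'd φ).continuousAt
  have h := whitened_fourth_cumulant_tree hΓop Y hUd hU'd hU''c hκ₀ hκ₁ ha hτ hδ hθ0 hθ1 hκθ hκθw hstab hU'b hU''b hlam hUsec hρg hHk hHk0 ψ hαr hαc
      hhr hlamA hlamA1 hγ hγ1 hD hDC hθnn hDθr hdθ hDθc hdθ' hσ0 hσθ hr1 hrσ haσ hβ haσ'
    (fun v c => whitened_sixth_power_integrable hΓop Y hUd hU'd hκ₀ hκ₁ ha hτ hδ hθ0 hθ1 hκθ hstab hU'b ψ v c)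
    (fun v => whitened_sixth_moment_gibbs hΓop Y hUd hU'd hU''c hκ₀ hκ₁ ha hτ hδ hθ0 hθ1 hκθ hstab hU'b hU''b hlam hUsec hρg ψ v) x y z t
  refine le_trans (le_of_eq ?_) h
  rw [whitened_mean_bridge hUc hU'c A ψ (EuclideanSpace.single x (1 : ℝ)), whitened_mean_bridge hUc hU'c A ψ (EuclideanSpace.single y (1 : ℝ)),
    whitened_mean_bridge hUc hU'c A ψ (EuclideanSpace.single z (1 : ℝ)), whitened_mean_bridge hUc hU'c A ψ (EuclideanSpace.single t (1 : ℝ)),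
    whitened_quad_bridge hUc hU'c A ψ, whitened_pair_bridge hUc hU'c A ψ, whitened_pair_bridge hUc hU'c A ψ, whitened_pair_bridge hUc hU'c A ψ,
    whitened_pair_bridge hUc hU'c A ψ, whitened_pair_bridge hUc hU'c A ψ, whitened_pair_bridge hUc hU'c A ψ]

end Kappa4

/-! ## §3. Toy -/

/-- Toy (§1 in numbers: a weighted average of values `≤ 3` is `≤ 3`): `(1+1)⁻¹·(1·2 + 1·3) ≤ 3`. -/
example : ((1 : ℝ) + 1)⁻¹ * (1 * 2 + 1 * 3) ≤ 3 := by norm_num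

end Summit.QuantumFields.BalabanUV.T4Continuum.NE7b.SupFourthKernelEntryPieces

end
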